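import Literature.MathematicalPhysics.KineticTheory.HardSphereEulerLLN
import HarnessLib

/-!
# Crux `RestartPrinciple` (stmt-AtomisticToContinuum-12503), line `Sketch`

## Stub `stub_activityInversion`: activity inversion for the canonical cluster series

Support file for the crux
`Summit.AtomisticToContinuum.HydrodynamicLimit.Theses.RelayRaceLocality.RestartPrinciple`
(route `RelayRaceLocality`), line `Sketch`: the REALISABILITY stub, part A (pure analysis).
In the canonical cluster expansion of the dilute hard-sphere gas (`HardSphereEulerLLN.rhoLim`)
the law-of-large-numbers density is the pointwise power series
`f_σ(y) = Σ_{j ≥ 0} γ_{j+1} y^{j+1}`, `γ_{j+1} = clusterCoeff σ j`, `γ₁ = 1`,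
`|γ_{j+1}| ≤ e (e v₁ σ³)ʲ` (`abs_clusterCoeff_le`). To restart the hydrodynamic limit from a
fresh local Gibbs gas with prescribed density `r` one has to invert this scalar series:
for every continuous positive target `r` with packing `r σ³ ≤ η₁ := 1 / (40 e v₁)` there is a
continuous positive activity `g`, `g ≤ 2 r`, `r ≤ 2 g`, with `f_σ (g x) = r x` (as a `HasSum`).

Proof. With `a = e v₁ σ³` and `0 ≤ y₁ ≤ y₂`, `a y₂ ≤ 1/20`, the series is dominated by the
geometric series `e y (1/20)ʲ`, and after splitting off the linear term (`γ₁ = 1`)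
`|f(y₂) - f(y₁) - (y₂ - y₁)| ≤ Σ_j e a^{j+1} (j+2) y₂^{j+1} (y₂ - y₁) ≤ e (y₂ - y₁) Σ_j (1/10)^{j+1}
 = e (y₂ - y₁) / 9 ≤ (y₂ - y₁) / 2` (`abs_pow_sub_pow_le`, `j + 2 ≤ 2^{j+1}`). Hence on
`[0, 2 r x]` (where `a · 2 r x ≤ 2 e v₁ η₁ = 1/20`): `f 0 = 0`, `y/2 ≤ f y ≤ 3y/2`, `f` is
`3/2`-Lipschitz and `f(y₂) - f(y₁) ≥ (y₂ - y₁)/2`. The intermediate value theorem on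
`[0, 2 r x]` gives `g x` with `f (g x) = r x`; `r x ≤ (3/2) g x` gives positivity and
`r ≤ 2 g`; the lower slope gives `|g x - g x₀| ≤ 2 |r x - r x₀|`, whence continuity of `g`.
-/

noncomputable section

open MeasureTheory Filter Set Topology Literature.MathematicalPhysics.KineticTheory

namespace Summit.AtomisticToContinuum.HydrodynamicLimit.Theorems.RestartPrinciple

/-- `γ₁ = 1`: the zeroth cluster coefficient (the limit coefficient of the uniform profile,
`coefLim_one_zero`). [folklore] -/
private theorem clusterCoeff_zero {σ : ℝ} (hσ : 0 < σ) : clusterCoeff σ 0 = 1 := by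
  have h1 := coefLim_one_zero (P := uniformProfile) hσ
  have hc : coefLim uniformProfile σ (fun _ => 1) 0 = clusterCoeff σ 0 := by
    rw [coefLim]
    simp [uniformProfile]
  rw [← hc, h1]

/-- `0 ≤ a = e v₁ σ³` for `σ ≥ 0`. [folklore] -/
private theorem ratio_nonneg {σ : ℝ} (hσ : 0 ≤ σ) : 0 ≤ Real.exp 1 * (v₁ * σ ^ 3) :=
  mul_nonneg (Real.exp_pos 1).le (mul_nonneg v₁_pos.le (pow_nonneg hσ 3))

/-- Termwise geometric bound `|γ_{j+1} y^{j+1}| ≤ e y (1/20)ʲ` for `0 ≤ y`, `a y ≤ 1/20`.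
[folklore] -/
private theorem abs_term_le {σ : ℝ} (hσ : 0 < σ) (hσ2 : σ < 1 / 2) {y : ℝ} (hy : 0 ≤ y)
    (hay : Real.exp 1 * (v₁ * σ ^ 3) * y ≤ 1 / 20) (j : ℕ) :
    |clusterCoeff σ j * y ^ (j + 1)| ≤ Real.exp 1 * y * (1 / 20) ^ j := by
  have ha0 := ratio_nonneg hσ.le
  rw [abs_mul, abs_of_nonneg (pow_nonneg hy _)]
  calc |clusterCoeff σ j| * y ^ (j + 1)
      ≤ (Real.exp 1 * (Real.exp 1 * (v₁ * σ ^ 3)) ^ j) * y ^ (j + 1) :=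
        mul_le_mul_of_nonneg_right (abs_clusterCoeff_le hσ hσ2 j) (pow_nonneg hy _)
    _ = Real.exp 1 * y * (Real.exp 1 * (v₁ * σ ^ 3) * y) ^ j := by rw [mul_pow, pow_succ]; ring
    _ ≤ Real.exp 1 * y * (1 / 20) ^ j :=
        mul_le_mul_of_nonneg_left (pow_le_pow_left₀ (mul_nonneg ha0 hy) hay j)
          (mul_nonneg (Real.exp_pos 1).le hy)

/-- The cluster series is (absolutely) summable for `0 ≤ y`, `a y ≤ 1/20`. [folklore] -/
private theorem summable_term {σ : ℝ} (hσ : 0 < σ) (hσ2 : σ < 1 / 2) {y : ℝ} (hy : 0 ≤ y)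
    (hay : Real.exp 1 * (v₁ * σ ^ 3) * y ≤ 1 / 20) :
    Summable fun j : ℕ => clusterCoeff σ j * y ^ (j + 1) :=
  Summable.of_norm_bounded
    ((summable_geometric_of_lt_one (by norm_num) (by norm_num)).mul_left (Real.exp 1 * y))
    fun j => (Real.norm_eq_abs _).trans_le (abs_term_le hσ hσ2 hy hay j)

/-- `f_σ(0) = 0`. [folklore] -/
private theorem series_zero (σ : ℝ) : ∑' j : ℕ, clusterCoeff σ j * (0 : ℝ) ^ (j + 1) = 0 := by
  simp

/-- Termwise bound for the nonlinear part of a difference: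
`|γ_{j+2} (y₂^{j+2} - y₁^{j+2})| ≤ e (y₂ - y₁) (1/10)^{j+1}` for `0 ≤ y₁ ≤ y₂`, `a y₂ ≤ 1/20`
(`abs_pow_sub_pow_le`, `j + 2 ≤ 2^{j+1}`). [folklore] -/
private theorem abs_diffTerm_le {σ : ℝ} (hσ : 0 < σ) (hσ2 : σ < 1 / 2) {y₁ y₂ : ℝ}
    (hy₁ : 0 ≤ y₁) (h12 : y₁ ≤ y₂) (hay : Real.exp 1 * (v₁ * σ ^ 3) * y₂ ≤ 1 / 20) (j : ℕ) :
    |clusterCoeff σ (j + 1) * (y₂ ^ (j + 1 + 1) - y₁ ^ (j + 1 + 1))| ≤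
      Real.exp 1 * (y₂ - y₁) * (1 / 10) ^ (j + 1) := by
  have hy₂ : 0 ≤ y₂ := hy₁.trans h12
  have ha0 := ratio_nonneg hσ.le
  have hγ : |clusterCoeff σ (j + 1)| ≤ Real.exp 1 * (Real.exp 1 * (v₁ * σ ^ 3)) ^ (j + 1) :=
    abs_clusterCoeff_le hσ hσ2 (j + 1)
  have hpow : |y₂ ^ (j + 1 + 1) - y₁ ^ (j + 1 + 1)| ≤
      (y₂ - y₁) * ((j + 1 + 1 : ℕ) : ℝ) * y₂ ^ (j + 1) := by
    have h := abs_pow_sub_pow_le y₂ y₁ (j + 1 + 1)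
    rwa [Nat.add_sub_cancel, abs_of_nonneg (sub_nonneg.2 h12), abs_of_nonneg hy₂,
      abs_of_nonneg hy₁, max_eq_left h12] at h
  have h2 : ((j + 1 + 1 : ℕ) : ℝ) ≤ 2 ^ (j + 1) := by
    exact_mod_cast (Nat.lt_two_pow_self : j + 1 < 2 ^ (j + 1))
  rw [abs_mul]
  calc |clusterCoeff σ (j + 1)| * |y₂ ^ (j + 1 + 1) - y₁ ^ (j + 1 + 1)|
      ≤ (Real.exp 1 * (Real.exp 1 * (v₁ * σ ^ 3)) ^ (j + 1)) *
          ((y₂ - y₁) * ((j + 1 + 1 : ℕ) : ℝ) * y₂ ^ (j + 1)) :=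
        mul_le_mul hγ hpow (abs_nonneg _) (mul_nonneg (Real.exp_pos 1).le (pow_nonneg ha0 _))
    _ = Real.exp 1 * (y₂ - y₁) *
          (((j + 1 + 1 : ℕ) : ℝ) * (Real.exp 1 * (v₁ * σ ^ 3) * y₂) ^ (j + 1)) := by
        rw [mul_pow]; ring
    _ ≤ Real.exp 1 * (y₂ - y₁) * (2 ^ (j + 1) * (1 / 20) ^ (j + 1)) :=
        mul_le_mul_of_nonneg_left
          (mul_le_mul h2 (pow_le_pow_left₀ (mul_nonneg ha0 hy₂) hay (j + 1))
            (pow_nonneg (mul_nonneg ha0 hy₂) _) (by positivity))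
          (mul_nonneg (Real.exp_pos 1).le (sub_nonneg.2 h12))
    _ = Real.exp 1 * (y₂ - y₁) * (1 / 10) ^ (j + 1) := by
        rw [← mul_pow]; norm_num

/-- **The key two-sided slope estimate** (ordered form): for `0 ≤ y₁ ≤ y₂`, `a y₂ ≤ 1/20`,
`|f_σ(y₂) - f_σ(y₁) - (y₂ - y₁)| ≤ (y₂ - y₁) / 2`. [folklore] -/
private theorem abs_series_sub_le {σ : ℝ} (hσ : 0 < σ) (hσ2 : σ < 1 / 2) {y₁ y₂ : ℝ}
    (hy₁ : 0 ≤ y₁) (h12 : y₁ ≤ y₂) (hay : Real.exp 1 * (v₁ * σ ^ 3) * y₂ ≤ 1 / 20) :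
    |(∑' j : ℕ, clusterCoeff σ j * y₂ ^ (j + 1)) - (∑' j : ℕ, clusterCoeff σ j * y₁ ^ (j + 1)) -
      (y₂ - y₁)| ≤ (y₂ - y₁) / 2 := by
  have hy₂ : 0 ≤ y₂ := hy₁.trans h12
  have ha0 := ratio_nonneg hσ.le
  have hay₁ : Real.exp 1 * (v₁ * σ ^ 3) * y₁ ≤ 1 / 20 :=
    (mul_le_mul_of_nonneg_left h12 ha0).trans hay
  have hs₁ := summable_term hσ hσ2 hy₁ hay₁
  have hs₂ := summable_term hσ hσ2 hy₂ hay
  have hsub : Summable fun j : ℕ => clusterCoeff σ j * (y₂ ^ (j + 1) - y₁ ^ (j + 1)) :=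
    (hs₂.sub hs₁).congr fun j => by ring
  have hdiff : (∑' j : ℕ, clusterCoeff σ j * y₂ ^ (j + 1)) -
      (∑' j : ℕ, clusterCoeff σ j * y₁ ^ (j + 1)) =
      ∑' j : ℕ, clusterCoeff σ j * (y₂ ^ (j + 1) - y₁ ^ (j + 1)) := by
    rw [← hs₂.tsum_sub hs₁]
    exact tsum_congr fun j => by ring
  rw [hdiff, hsub.tsum_eq_zero_add, clusterCoeff_zero hσ, one_mul, zero_add, pow_one, pow_one,
    add_sub_cancel_left]
  have hδ : 0 ≤ y₂ - y₁ := sub_nonneg.2 h12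
  have hgeo : HasSum (fun j : ℕ => Real.exp 1 * (y₂ - y₁) * (1 / 10) ^ (j + 1))
      (Real.exp 1 * (y₂ - y₁) * (1 / 9)) := by
    have h := (hasSum_geometric_of_lt_one (by norm_num : (0 : ℝ) ≤ 1 / 10)
      (by norm_num : (1 : ℝ) / 10 < 1)).mul_left (Real.exp 1 * (y₂ - y₁) * (1 / 10))
    rw [show Real.exp 1 * (y₂ - y₁) * (1 / 10) * (1 - 1 / 10)⁻¹ =
      Real.exp 1 * (y₂ - y₁) * (1 / 9) by norm_num; ring] at h
    refine h.congr_fun fun j => ?_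
    ring
  refine (Real.norm_eq_abs _).symm.trans_le ((tsum_of_norm_bounded hgeo fun j => ?_).trans ?_)
  · rw [Real.norm_eq_abs]
    exact abs_diffTerm_le hσ hσ2 hy₁ h12 hay j
  · have he : Real.exp 1 < 3 := Real.exp_one_lt_three
    have : Real.exp 1 * (y₂ - y₁) ≤ 3 * (y₂ - y₁) := mul_le_mul_of_nonneg_right he.le hδ
    linarith

/-- The key slope estimate, symmetric form: for `0 ≤ y₁, y₂` with `a yᵢ ≤ 1/20`,
`|f_σ(y₂) - f_σ(y₁) - (y₂ - y₁)| ≤ |y₂ - y₁| / 2`. [folklore] -/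
private theorem abs_series_sub_le' {σ : ℝ} (hσ : 0 < σ) (hσ2 : σ < 1 / 2) {y₁ y₂ : ℝ}
    (hy₁ : 0 ≤ y₁) (hy₂ : 0 ≤ y₂) (ha₁ : Real.exp 1 * (v₁ * σ ^ 3) * y₁ ≤ 1 / 20)
    (ha₂ : Real.exp 1 * (v₁ * σ ^ 3) * y₂ ≤ 1 / 20) :
    |(∑' j : ℕ, clusterCoeff σ j * y₂ ^ (j + 1)) - (∑' j : ℕ, clusterCoeff σ j * y₁ ^ (j + 1)) -
      (y₂ - y₁)| ≤ |y₂ - y₁| / 2 := by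
  rcases le_total y₁ y₂ with h | h
  · rw [abs_of_nonneg (sub_nonneg.2 h)]
    exact abs_series_sub_le hσ hσ2 hy₁ h ha₂
  · rw [show (∑' j : ℕ, clusterCoeff σ j * y₂ ^ (j + 1)) -
        (∑' j : ℕ, clusterCoeff σ j * y₁ ^ (j + 1)) - (y₂ - y₁) =
        -((∑' j : ℕ, clusterCoeff σ j * y₁ ^ (j + 1)) -
          (∑' j : ℕ, clusterCoeff σ j * y₂ ^ (j + 1)) - (y₁ - y₂)) by ring,
      abs_neg, abs_sub_comm y₂ y₁, abs_of_nonneg (sub_nonneg.2 h)]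
    exact abs_series_sub_le hσ hσ2 hy₂ h ha₁

/-- `f_σ` is continuous on `[0, b]` whenever `a b ≤ 1/20` (it is `3/2`-Lipschitz there).
[folklore] -/
private theorem continuousOn_series {σ : ℝ} (hσ : 0 < σ) (hσ2 : σ < 1 / 2) {b : ℝ}
    (hab : Real.exp 1 * (v₁ * σ ^ 3) * b ≤ 1 / 20) :
    ContinuousOn (fun y : ℝ => ∑' j : ℕ, clusterCoeff σ j * y ^ (j + 1)) (Icc 0 b) := by
  have ha0 := ratio_nonneg hσ.le
  rw [Metric.continuousOn_iff]
  intro y₀ hy₀ ε hε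
  refine ⟨ε / 2, half_pos hε, fun y hy hyy₀ => ?_⟩
  simp only [Real.dist_eq] at hyy₀ ⊢
  have h := abs_series_sub_le' hσ hσ2 hy₀.1 hy.1
    ((mul_le_mul_of_nonneg_left hy₀.2 ha0).trans hab)
    ((mul_le_mul_of_nonneg_left hy.2 ha0).trans hab)
  have h2 : |(∑' j : ℕ, clusterCoeff σ j * y ^ (j + 1)) -
        (∑' j : ℕ, clusterCoeff σ j * y₀ ^ (j + 1))| ≤
      |(∑' j : ℕ, clusterCoeff σ j * y ^ (j + 1)) - (∑' j : ℕ, clusterCoeff σ j * y₀ ^ (j + 1)) -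
          (y - y₀)| + |y - y₀| := by
    have := abs_add_le ((∑' j : ℕ, clusterCoeff σ j * y ^ (j + 1)) -
      (∑' j : ℕ, clusterCoeff σ j * y₀ ^ (j + 1)) - (y - y₀)) (y - y₀)
    rwa [sub_add_cancel] at this
  have h3 : 0 ≤ |y - y₀| := abs_nonneg _
  linarith

/-- **Activity inversion for the canonical cluster series** (REALISABILITY, part A of the static
half of BET 2 of line `Sketch`). With `γ_{j+1} = clusterCoeff σ j` (`γ₁ = 1`,
`|γ_{j+1}| ≤ e (e v₁ σ³)ʲ`) the density of the dilute hard-sphere gas is the pointwise series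
`f_σ(y) = Σ_j γ_{j+1} y^{j+1}`; for `η₁ = 1 / (40 e v₁)`, every `0 < σ < 1/2` and every
continuous positive target `r` with packing `r σ³ ≤ η₁` there is a continuous positive `g`,
`g ≤ 2 r`, `r ≤ 2 g`, with `Σ_j γ_{j+1} (g x)^{j+1} = r x` for all `x` (intermediate value
theorem on `[0, 2 r x]`, where `f_σ` has slope in `[1/2, 3/2]`; continuity of the inverse from
the lower slope). [folklore] -/
theorem stub_activityInversion :
    ∃ η₁ : ℝ, 0 < η₁ ∧ ∀ σ : ℝ, 0 < σ → σ < 1 / 2 → ∀ r : T3 → ℝ, Continuous r → (∀ x, 0 < r x) →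
      (∀ x, r x * σ ^ 3 ≤ η₁) →
      ∃ g : T3 → ℝ, Continuous g ∧ (∀ x, 0 < g x) ∧ (∀ x, g x ≤ 2 * r x) ∧ (∀ x, r x ≤ 2 * g x) ∧
        ∀ x, HasSum (fun j : ℕ => clusterCoeff σ j * g x ^ (j + 1)) (r x) := by
  have hev : 0 < Real.exp 1 * v₁ := mul_pos (Real.exp_pos 1) v₁_pos
  have h40 : 0 < 40 * Real.exp 1 * v₁ := by rw [mul_assoc]; exact mul_pos (by norm_num) hev
  refine ⟨1 / (40 * Real.exp 1 * v₁), div_pos one_pos h40, fun σ hσ hσ2 r hr hr0 hpack => ?_⟩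
  have ha0 := ratio_nonneg hσ.le
  -- the working interval `[0, 2 r x]` is dilute: `a · (2 r x) ≤ 1/20`
  have hbound : ∀ x, Real.exp 1 * (v₁ * σ ^ 3) * (2 * r x) ≤ 1 / 20 := by
    intro x
    have h' : Real.exp 1 * v₁ * (r x * σ ^ 3) ≤ Real.exp 1 * v₁ * (1 / (40 * Real.exp 1 * v₁)) :=
      mul_le_mul_of_nonneg_left (hpack x) hev.le
    have h'' : Real.exp 1 * v₁ * (1 / (40 * Real.exp 1 * v₁)) = 1 / 40 := by
      rw [mul_one_div, div_eq_iff h40.ne']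
      ring
    calc Real.exp 1 * (v₁ * σ ^ 3) * (2 * r x) = 2 * (Real.exp 1 * v₁ * (r x * σ ^ 3)) := by ring
      _ ≤ 2 * (1 / 40) := by rw [← h'']; linarith
      _ = 1 / 20 := by norm_num
  -- pointwise inversion by the intermediate value theorem on `[0, 2 r x]`
  have hex : ∀ x, ∃ y, y ∈ Icc (0 : ℝ) (2 * r x) ∧
      ∑' j : ℕ, clusterCoeff σ j * y ^ (j + 1) = r x := by
    intro x
    have hb := hbound x
    have hr2 : (0 : ℝ) ≤ 2 * r x := by have := hr0 x; positivity
    have hmem : r x ∈ Icc (∑' j : ℕ, clusterCoeff σ j * (0 : ℝ) ^ (j + 1))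
        (∑' j : ℕ, clusterCoeff σ j * (2 * r x) ^ (j + 1)) := by
      refine ⟨by rw [series_zero]; exact (hr0 x).le, ?_⟩
      have h := abs_series_sub_le hσ hσ2 le_rfl hr2 hb
      rw [series_zero, sub_zero, sub_zero] at h
      have := (abs_le.1 h).1
      linarith
    obtain ⟨y, hy, hfy⟩ := intermediate_value_Icc hr2 (continuousOn_series hσ hσ2 hb) hmem
    exact ⟨y, hy, hfy⟩
  choose g hg hfg using hex
  have hga : ∀ x, Real.exp 1 * (v₁ * σ ^ 3) * g x ≤ 1 / 20 := fun x =>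
    (mul_le_mul_of_nonneg_left (hg x).2 ha0).trans (hbound x)
  -- `r x = f (g x) ≤ (3/2) g x`
  have hlow : ∀ x, r x ≤ 3 / 2 * g x := by
    intro x
    have h := abs_series_sub_le hσ hσ2 le_rfl (hg x).1 (hga x)
    rw [series_zero, sub_zero, sub_zero, hfg x] at h
    have := (abs_le.1 h).2
    linarith
  refine ⟨g, ?_, fun x => ?_, fun x => (hg x).2, fun x => ?_, fun x => ?_⟩
  · -- continuity of the inverse: `|g x - g x₀| ≤ 2 |r x - r x₀|`
    rw [Metric.continuous_iff]
    intro x₀ ε hε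
    obtain ⟨δ, hδ, hδr⟩ := Metric.continuous_iff.1 hr x₀ (ε / 2) (half_pos hε)
    refine ⟨δ, hδ, fun x hx => ?_⟩
    have hrx := hδr x hx
    rw [Real.dist_eq] at hrx ⊢
    have h := abs_series_sub_le' hσ hσ2 (hg x₀).1 (hg x).1 (hga x₀) (hga x)
    rw [hfg x, hfg x₀] at h
    have h2 : |g x - g x₀| ≤ |r x - r x₀| + |r x - r x₀ - (g x - g x₀)| := by
      have := abs_sub (r x - r x₀) (r x - r x₀ - (g x - g x₀))
      rwa [sub_sub_cancel] at this
    linarith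
  · have := hlow x
    have := hr0 x
    linarith
  · have := hlow x
    have := (hg x).1
    linarith
  · exact (summable_term hσ hσ2 (hg x).1 (hga x)).hasSum_iff.2 (hfg x)

end Summit.AtomisticToContinuum.HydrodynamicLimit.Theorems.RestartPrinciple

end
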